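import Mathlib
import HarnessLib

/-!
# The average-cut decomposition — registered stub `stub_averageCut` (W13; crux `RankDefectRepresentations` = stmt-PneNP-18923, line `rank-dehn-ladder`, RESHAPE 13)

Rows `x : ι` and columns `y : ι'` of a matrix `R` carry colours `row x, col y : Q` (a finite colour type).  For a colour set
`B : Finset Q` the BIPARTITION CUT of `R` at `B` is
`μ(B) := rank (R ∘ 1[(row ∈ B) × (col ∉ B)]) + rank (R ∘ 1[(row ∉ B) × (col ∈ B)])`.

THEOREM (`stub_averageCut`, the registered signature verbatim from `Cruxes/RankDefectRepresentations/Lines/rank_dehn_ladder.lean`,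
RESHAPE 13, lead g16): ASSUMING the LOCAL CUT INEQUALITY (the conclusion of the neighbouring stub `stub_localCut`, W12, taken here as an
explicit hypothesis) — for every colour set `B` the matrix `R` is within rank
`cost(B) := 4 μ(B) + Σ_{i : Q} (μ(B △ {i}) − μ(B))` of a colour-block-diagonal matrix — the matrix `R` is within rank `4 · avg_B μ(B)` of a
colour-block-diagonal one, stated over `ℕ` as `2^{#Q} · rank (R − R') ≤ 4 · Σ_{B : Finset Q} μ(B)`.

PROOF (brief `Lines/rank-dehn-ladder-briefs-g16.md` §W13).  (1) CANCELLATION: for each colour `i`, `B ↦ B △ {i}` is an involution of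
`Finset Q` (`symmDiff_symmDiff_cancel_right`), so `Σ_B μ(B △ {i}) = Σ_B μ(B)` (`Fintype.sum_equiv`) and the signed slack terms cancel on
average: `Σ_B cost(B) = 4 Σ_B μ(B)` (`sum_cost_eq`).  (2) MINIMUM ≤ AVERAGE: a colour set `B₀` of minimal cost has
`#(Finset Q) · cost(B₀) ≤ Σ_B cost(B)` (`Finset.exists_min_image`, `Finset.card_nsmul_le_sum`) and `#(Finset Q) = 2^{#Q}` (`Fintype.card_finset`).
(3) The hypothesis at `B₀` supplies the block-diagonal `R'`.  Everything is elementary bookkeeping over `ℤ`; Mathlib only.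

HONEST FRAMING: a TOOL of the average-cut lane (memo `Lines/rank-dehn-ladder-g16.md` §1); it closes no rung by itself; P ≠ NP is not moved;
F-N2 is a FRONTIER formal rung.
-/

set_option linter.dupNamespace false -- `Summit.PneNP.PneNP.…`: summit = sub-problem name (D-0017)

namespace Summit.PneNP.PneNP.Theorems.CnfIdealGenLengthRankDefectRepresentationsAverageCut

open Finset

/-- Re-indexing a sum over all colour sets by the toggle involution: `Σ_B f(B △ {i}) = Σ_B f(B)`.  Toggling a fixed
colour `i`, `B ↦ B △ {i}`, is a self-inverse bijection of `Finset Q` (`symmDiff_symmDiff_cancel_right : a △ b △ b = a`),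
used here as an explicit `Equiv` to re-index the sum (`Fintype.sum_equiv`). [folklore] -/
theorem sum_symmDiff_singleton {Q : Type} [Fintype Q] [DecidableEq Q] {M : Type} [AddCommMonoid M]
    (f : Finset Q → M) (i : Q) :
    ∑ B : Finset Q, f (symmDiff B {i}) = ∑ B : Finset Q, f B :=
  Fintype.sum_equiv
    ⟨fun B => symmDiff B {i}, fun B => symmDiff B {i},
      fun B => symmDiff_symmDiff_cancel_right {i} B, fun B => symmDiff_symmDiff_cancel_right {i} B⟩
    (fun B => f (symmDiff B {i})) f (fun _ => rfl)

/-- CANCELLATION of the signed slack on average: for any `μ : Finset Q → ℤ`,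
`Σ_B (4 μ(B) + Σ_i (μ(B △ {i}) − μ(B))) = 4 Σ_B μ(B)` — the inner differences vanish after summing over `B`
because `B ↦ B △ {i}` permutes `Finset Q` (`sum_symmDiff_singleton`). [folklore] -/
theorem sum_cost_eq {Q : Type} [Fintype Q] [DecidableEq Q] (μ : Finset Q → ℤ) :
    ∑ B : Finset Q, (4 * μ B + ∑ i : Q, (μ (symmDiff B {i}) - μ B)) = 4 * ∑ B : Finset Q, μ B := by
  have hzero : ∑ i : Q, ∑ B : Finset Q, (μ (symmDiff B {i}) - μ B) = 0 := by
    refine Finset.sum_eq_zero fun i _ => ?_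
    rw [Finset.sum_sub_distrib, sum_symmDiff_singleton μ i, sub_self]
  rw [Finset.sum_add_distrib, Finset.sum_comm, hzero, add_zero, ← Finset.mul_sum]

/-- MINIMUM ≤ AVERAGE over all colour sets: for any `cost : Finset Q → ℤ` there is a colour set `B₀` with
`2^{#Q} · cost(B₀) ≤ Σ_B cost(B)` (`#(Finset Q) = 2^{#Q}`, `Fintype.card_finset`). [folklore] -/
theorem exists_pow_mul_le_sum {Q : Type} [Fintype Q] [DecidableEq Q] (cost : Finset Q → ℤ) :
    ∃ B₀ : Finset Q, (2 : ℤ) ^ Fintype.card Q * cost B₀ ≤ ∑ B : Finset Q, cost B := by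
  obtain ⟨B₀, -, hmin⟩ :=
    Finset.exists_min_image (Finset.univ : Finset (Finset Q)) cost Finset.univ_nonempty
  refine ⟨B₀, ?_⟩
  have h := Finset.card_nsmul_le_sum (Finset.univ : Finset (Finset Q)) cost (cost B₀)
    (fun B _ => hmin B (Finset.mem_univ B))
  rw [Finset.card_univ, Fintype.card_finset, nsmul_eq_mul] at h
  exact_mod_cast h

/-- **Registered stub `stub_averageCut`** (W13, line `rank-dehn-ladder`, RESHAPE 13; signature verbatim from the skeleton
`Cruxes/RankDefectRepresentations/Lines/rank_dehn_ladder.lean`) = the AVERAGE-CUT DECOMPOSITION: from the local cut inequality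
(W12's conclusion, the hypothesis) — for every colour set `B`, `R` is within rank `4 μ(B) + Σ_{i : Q} (μ(B △ {i}) − μ(B))` of a
colour-block-diagonal matrix — it follows that `R` is within rank `4 · avg_B μ(B)` of a colour-block-diagonal matrix:
`2^{#Q} · rank (R − R') ≤ 4 · Σ_{B : Finset Q} μ(B)`.  Proof: sum the hypothesis' cost over all `B` (the signed slack cancels,
`sum_cost_eq`) and take a `B₀` of minimal cost (`exists_pow_mul_le_sum`). -/
theorem stub_averageCut :
    (∀ (K : Type) [Field K] (ι ι' Q : Type) [Fintype ι] [Fintype ι'] [DecidableEq ι] [DecidableEq ι'] [Fintype Q] [DecidableEq Q]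
      (row : ι → Q) (col : ι' → Q) (R : Matrix ι ι' K) (B : Finset Q),
      ∃ R' : Matrix ι ι' K, (∀ x y, row x ≠ col y → R' x y = 0) ∧
        ((R - R').rank : ℤ) ≤
          4 * (((Matrix.of fun x y => if row x ∈ B ∧ col y ∉ B then R x y else 0).rank : ℤ) +
              ((Matrix.of fun x y => if row x ∉ B ∧ col y ∈ B then R x y else 0).rank : ℤ)) +
          ∑ i : Q, ((((Matrix.of fun x y => if row x ∈ symmDiff B {i} ∧ col y ∉ symmDiff B {i} then R x y else 0).rank : ℤ) +
              ((Matrix.of fun x y => if row x ∉ symmDiff B {i} ∧ col y ∈ symmDiff B {i} then R x y else 0).rank : ℤ)) -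
            (((Matrix.of fun x y => if row x ∈ B ∧ col y ∉ B then R x y else 0).rank : ℤ) +
              ((Matrix.of fun x y => if row x ∉ B ∧ col y ∈ B then R x y else 0).rank : ℤ)))) →
    ∀ (K : Type) [Field K] (ι ι' Q : Type) [Fintype ι] [Fintype ι'] [DecidableEq ι] [DecidableEq ι'] [Fintype Q] [DecidableEq Q]
      (row : ι → Q) (col : ι' → Q) (R : Matrix ι ι' K),
      ∃ R' : Matrix ι ι' K, (∀ x y, row x ≠ col y → R' x y = 0) ∧
        2 ^ Fintype.card Q * (R - R').rank ≤
          4 * ∑ B : Finset Q, ((Matrix.of fun x y => if row x ∈ B ∧ col y ∉ B then R x y else 0).rank +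
              (Matrix.of fun x y => if row x ∉ B ∧ col y ∈ B then R x y else 0).rank) := by
  intro hLC K _ ι ι' Q _ _ _ _ _ _ row col R
  -- the bipartition cut `μ(B)` (over `ℤ`) and the cost of the local cut inequality at `B`
  let μ : Finset Q → ℤ := fun B =>
    ((Matrix.of fun x y => if row x ∈ B ∧ col y ∉ B then R x y else 0).rank : ℤ) +
      ((Matrix.of fun x y => if row x ∉ B ∧ col y ∈ B then R x y else 0).rank : ℤ)
  let cost : Finset Q → ℤ := fun B => 4 * μ B + ∑ i : Q, (μ (symmDiff B {i}) - μ B)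
  -- (2) a colour set of minimal cost: `2^{#Q} · cost B₀ ≤ Σ_B cost B`
  obtain ⟨B₀, hB₀⟩ := exists_pow_mul_le_sum cost
  -- (3) the local cut inequality at `B₀`
  obtain ⟨R', hR', hrank⟩ := hLC K ι ι' Q row col R B₀
  refine ⟨R', hR', ?_⟩
  have hrank' : ((R - R').rank : ℤ) ≤ cost B₀ := hrank
  -- (1) cancellation: `Σ_B cost B = 4 Σ_B μ B`
  have hsum : ∑ B : Finset Q, cost B = 4 * ∑ B : Finset Q, μ B := sum_cost_eq μ
  have h2 : (0 : ℤ) ≤ (2 : ℤ) ^ Fintype.card Q := by positivity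
  have key : (2 : ℤ) ^ Fintype.card Q * ((R - R').rank : ℤ) ≤ 4 * ∑ B : Finset Q, μ B :=
    calc (2 : ℤ) ^ Fintype.card Q * ((R - R').rank : ℤ)
        ≤ (2 : ℤ) ^ Fintype.card Q * cost B₀ := mul_le_mul_of_nonneg_left hrank' h2
      _ ≤ ∑ B : Finset Q, cost B := hB₀
      _ = 4 * ∑ B : Finset Q, μ B := hsum
  have key' : ((2 ^ Fintype.card Q * (R - R').rank : ℕ) : ℤ) ≤
      ((4 * ∑ B : Finset Q, ((Matrix.of fun x y => if row x ∈ B ∧ col y ∉ B then R x y else 0).rank +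
          (Matrix.of fun x y => if row x ∉ B ∧ col y ∈ B then R x y else 0).rank) : ℕ) : ℤ) := by
    push_cast
    exact key
  exact_mod_cast key'

end Summit.PneNP.PneNP.Theorems.CnfIdealGenLengthRankDefectRepresentationsAverageCut
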